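import Summits.QuantumFields.YangMills.Theorems.BalabanUVNodesN12FlatChartDerivIterLin
import Summits.QuantumFields.YangMills.Theorems.UnitScaleTiltProp8ChartHInvComb
import Literature.MathematicalPhysics.QuantumFieldTheory.Balaban1983to89.Node00.LinearisedAveragingFlat
import Summits.QuantumFields.YangMills.Theorems.UnitScaleTiltProp8ChartKernelTube
import Literature.MathematicalPhysics.QuantumFieldTheory.Balaban1983to89.MatrixNorms
import Literature.MathematicalPhysics.QuantumFieldTheory.Balaban1983to89.TorusHypercubicSymmetry
import Mathlib.Algebra.Order.Chebyshev
import HarnessLib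

/-!
# BalabanUVNodes ∕ N12 — (J-b) module H4: THE LETTER FLOOR OF EVERY RIGHT INVERSE OF THE FLAT LINEARISED MULTI-SCALE (0.4)-CONSTRAINT IN THE JUNCTION's CURRENCY
# (`p ≥` bond-`ℓ²`, `q =` sup): `(L^d)^j·‖E‖²_op ≤ 16·(L²)^j·ρ²·‖E‖²_HS` as soon as the rows contain the four bonds of a level-`j` plaquette

Cell `pub-ymgap` (HUMAN RULINGS D-0062 ∕ D-0149), width seat `pub-ymgap-dag-n10-w1` g4 (modules A–E g0, F∕F′∕G1∕G2 g2, H1a∕H1b∕H2a∕H2b∕H3 g3 of this lineage landed, p592369 … p621280).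
`--kind proof --supports … --as helper`; count-neutral; THEOREMS ONLY (0 `def`, 0 `sorry`, 0 `instance`, 0 `notation`).  CONSUMED BY NAME, nothing modified: module B
`…N12FlatChartDerivIterLin` (`iterLin_eq_of_rightInverse`, `iterLin_mem_lieSU`), UST `ChartHInv` (`exists_linFamily`, `exists_combFamily`, `linFamily_eq_sub_comb`: `Q^{(j)} = L^j·Q_j − dΛ_j`),
lit-balaban `B8Prop3MultiLevelTorus` (`sum_bondAvgIter` = column mass `(L^d)^{−j}`, `bondAvgIter_nonneg`), UST `ChartKernelTube` (`norm_bondAvg_le_bondAvg_norm`), NODE 00 (`qLin`, `qLin_one_eq_family`, `suProj`, `coe_suProj_of_mem`, `msChart`, `constrEnum`),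
Mathlib `sq_sum_le_card_mul_sum_sq`.

WHY (a LOCATED currency note for the N12 lane; nothing refuted).  J-C v1.2 (`B15Prop1EndpointNearFlatLetters` §5, p618172; knit 12Q⁸; n12-c g18's `hNFn`) binds per instance the
near-flat package (N): a seminorm `p` with `hp : Σ_b‖↑(Y b)‖² ≤ p(Y)²` (bond-`ℓ²` of OPERATOR norms), a size `q`, the knit's flat `Lf` (module B: `π ∘ Q^{(j)}` on the rows), `Rf` with
`hRf : Lf (Rf v) = v`, `hρ : p(Rf v) ≤ ρc·q v`, (δ₂) `q(DΨ(0)w − Lf w) ≤ δ₂c·p(w)`, and `hsm : (32(d−1)δc + μc + 16(d−1)ρcδ₂c(2+ρcδ₂c))·Kc² + τc ≤ γ₀∕(2(3K²+2K⁴))`;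
n12-w4's `…N12NearFlatDelta2Letter` reads `q := ‖·‖` = sup of `𝔰𝔲(N)`'s pinned Hilbert–Schmidt norms, `ρ♭`∕`C` per-height EXISTENCE constants.  THIS FILE: in that reading EVERY `Rf` has
`(L^d)^j·‖↑E‖²_op ≤ 16·(L²)^j·ρ²·‖E‖²_HS` as soon as the rows contain a level-`j` plaquette (§4: `ρ ≥ L^{(d−2)j∕2}∕(4√N)`; d = 4, N = 2, level k: `ρc ≥ L^k∕(4√2)`).  MECHANISM:
the alternating sum of the four reproduced constraints kills the comb gradient `dΛ_j` (§2), leaving `L^j·Σ_{∂p}±(Q_jY)`, and `Q_j` is `ℓ²`-SMOOTHING (§1, Jensen + column mass).  CONSEQUENCE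
for `hsm` (arithmetic): `32(d−1)ρcδ₂cKc² ≤ γ₀∕(2(3K²+2K⁴))` forces `δ₂c·Kc² ≤ γ₀√2∕(48·L^k·(3K²+2K⁴))` at d = 4 — the (δ₂) letter must carry `L^{−k}` (module D's sup-currency constant
shows none), or `(p, q)` be re-typed in η-units on both sides (print's (17)–(19)), or `Lf := DΨ(0)`.  NOT a claim that (N) ∧ `hsm` is uninhabitable (`δ₂c` has no floor; it is 0 at `U₀ = 1`).

CONTENTS.  §1 `bondAvg_mono`, `sq_bondAvg_le` (one-level Jensen), ★ `norm_sq_bondAvgIter_le_bondAvgIter`, ★★ `norm_sq_bondAvgIter_mul_le` (`‖(Q_jY)(c)‖²·(L^d)^j ≤ Σ_b‖Y_b‖²`).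
§2 ★ `linFamily_plaquette`.  §3 ★★ `letter_floor_of_reproduce` (matrix-level core), `letter_floor_of_reproduce_single` (test datum `δ_{i₁}·E`).  §4 `reproduce_of_qLin`, `constrEnum_ne_of_ne`,
★★★ `letter_floor_qLin` (module F ∕ H3 currency), ★★★ `letter_floor_fderiv_msChart_one[_single]` (J-C's `Lf`), `norm_sq_lieSU_le_card_mul_opNorm_sq` (‖E‖²_HS ≤ N‖↑E‖²_op), ★★★ `letter_floor_fderiv_msChart_one_Bj_single` ∕ `…_Bj_numeral` (at `Bj M₁ Z k`, level `k`: `(L^d)^k ≤ 16N(L²)^kρ²`).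

HONEST FRAMING.  Finite-dimensional linear algebra + lattice bookkeeping on the tree's own straight averages at the FLAT configuration; a LOWER bound on one letter in ONE currency — no estimate of
Bałaban's asserted or denied ((46) for print's `H` is an `L²`-type statement in η-units, untouched); ME #35 not adjudicated; N12 ∕ N10 ∕ N07 NOT discharged; K1⁷∕K1⁸ NOT closed; count-neutral (typed
28∕28 · discharged 5∕27 unmoved); one finite 𝕋⁴ programme at fixed ε — R4 closes the conditional finite-𝕋⁴ rung `BalabanLadder.UV` only; the YM mass gap (Clay) is NOT proved by any of this;
nothing continuum ∕ ℝ⁴ ∕ OS.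
-/

noncomputable section
open scoped BigOperators Matrix.Norms.L2Operator
open Finset
namespace Summit.QuantumFields.YangMills.BalabanUVNodes.N12FlatRightInverseLetterFloor

open Literature.MathematicalPhysics.QuantumFieldTheory.Balaban1983to89
open LatticeFieldCalculus (bondAvg bondAvgIter segSum runBond)
open T4Continuum (T4Family)
open BlockAveragingEMLLinearised (linAvg)
open T4AdjointCovarianceUnitary (lieSU)
open B15DeterminingSets
open B14.Eq213DetSet (Bj maxDomT Bj_top)
open Node00
open B8Prop3MultiLevelTorus (sum_bondAvgIter bondAvgIter_nonneg)
open Summit.QuantumFields.YangMills.Theorems.ChartHInv (exists_linFamily exists_combFamily linFamily_eq_sub_comb)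
open Summit.QuantumFields.YangMills.Theorems.ChartKernelTube (norm_bondAvg_le_bondAvg_norm)
open Summit.QuantumFields.YangMills.BalabanUVNodes.N12FlatChartDerivIterLin (iterLin_eq_of_rightInverse iterLin_mem_lieSU)

variable {P : Params}

/-! ## §1  `ℓ²`-smoothing of the straight `j`-fold average `Q_j` -/

section Smoothing

variable {j : ℕ}

/-- The block average (1.11) is monotone on real fields (non-negative weights). [cite: Balaban1984PropagatorsI, (1.11) p.19] -/
theorem bondAvg_mono {G G' : VecField P j ℝ} (h : ∀ b, G b ≤ G' b) (c : PBond P (j + 1)) : bondAvg G c ≤ bondAvg G' c := by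
  unfold bondAvg segSum
  simp only [smul_eq_mul]
  exact mul_le_mul_of_nonneg_left (Finset.sum_le_sum fun r _ => Finset.sum_le_sum fun t _ => h _) (by positivity)

/-- **One-level Jensen**: `((QG)(c))² ≤ (Q(G²))(c)` — the block average (1.11) is a plain average of `L^{d+1}` terms (Cauchy–Schwarz over the offsets and along the contour).
[cite: Balaban1984PropagatorsI, (1.11) p.19] -/
theorem sq_bondAvg_le (G : VecField P j ℝ) (c : PBond P (j + 1)) : (bondAvg G c) ^ 2 ≤ bondAvg (fun b => G b ^ 2) c := by
  unfold bondAvg segSum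
  simp only [smul_eq_mul]
  set s : ℝ := (P.L : ℝ) ^ (P.d + 1) with hs
  have hs0 : 0 < s := by have := P.L_pos; positivity
  have h1 : (∑ r : Fin P.d → Fin P.L, ∑ t ∈ Finset.range P.L, G (runBond (Site.blockSite c.src r) c.dir t)) ^ 2 ≤
      ((Finset.univ : Finset (Fin P.d → Fin P.L)).card : ℝ) *
        ∑ r : Fin P.d → Fin P.L, (∑ t ∈ Finset.range P.L, G (runBond (Site.blockSite c.src r) c.dir t)) ^ 2 :=
    sq_sum_le_card_mul_sum_sq
  have h2 : ∀ r : Fin P.d → Fin P.L, (∑ t ∈ Finset.range P.L, G (runBond (Site.blockSite c.src r) c.dir t)) ^ 2 ≤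
      (P.L : ℝ) * ∑ t ∈ Finset.range P.L, G (runBond (Site.blockSite c.src r) c.dir t) ^ 2 := fun r => by
    have := sq_sum_le_card_mul_sum_sq (s := Finset.range P.L) (f := fun t => G (runBond (Site.blockSite c.src r) c.dir t))
    rwa [Finset.card_range] at this
  have hcard : ((Finset.univ : Finset (Fin P.d → Fin P.L)).card : ℝ) = (P.L : ℝ) ^ P.d := by
    rw [Finset.card_univ, Fintype.card_fun, Fintype.card_fin, Fintype.card_fin]; push_cast; ring
  have h3 : (∑ r : Fin P.d → Fin P.L, ∑ t ∈ Finset.range P.L, G (runBond (Site.blockSite c.src r) c.dir t)) ^ 2 ≤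
      s * ∑ r : Fin P.d → Fin P.L, ∑ t ∈ Finset.range P.L, G (runBond (Site.blockSite c.src r) c.dir t) ^ 2 :=
    calc _ ≤ _ := h1
      _ = (P.L : ℝ) ^ P.d * ∑ r : Fin P.d → Fin P.L, (∑ t ∈ Finset.range P.L, G (runBond (Site.blockSite c.src r) c.dir t)) ^ 2 := by rw [hcard]
      _ ≤ (P.L : ℝ) ^ P.d * ∑ r : Fin P.d → Fin P.L, ((P.L : ℝ) * ∑ t ∈ Finset.range P.L, G (runBond (Site.blockSite c.src r) c.dir t) ^ 2) :=
          mul_le_mul_of_nonneg_left (Finset.sum_le_sum fun r _ => h2 r) (by positivity)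
      _ = s * ∑ r : Fin P.d → Fin P.L, ∑ t ∈ Finset.range P.L, G (runBond (Site.blockSite c.src r) c.dir t) ^ 2 := by
          rw [hs, pow_succ, mul_assoc]
          congr 1
          rw [Finset.mul_sum]
  rw [mul_pow]
  calc (s⁻¹) ^ 2 * (∑ r : Fin P.d → Fin P.L, ∑ t ∈ Finset.range P.L, G (runBond (Site.blockSite c.src r) c.dir t)) ^ 2
      ≤ (s⁻¹) ^ 2 * (s * ∑ r : Fin P.d → Fin P.L, ∑ t ∈ Finset.range P.L, G (runBond (Site.blockSite c.src r) c.dir t) ^ 2) :=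
        mul_le_mul_of_nonneg_left h3 (by positivity)
    _ = s⁻¹ * ∑ r : Fin P.d → Fin P.L, ∑ t ∈ Finset.range P.L, G (runBond (Site.blockSite c.src r) c.dir t) ^ 2 := by
        field_simp

variable {V : Type*} [NormedAddCommGroup V] [NormedSpace ℝ V]

/-- ★ **`Q_j` IS `ℓ²`-SMOOTHING, POINTWISE (multi-level Jensen)**: `‖(Q_jY)(c)‖² ≤ (Q_j(‖Y‖²))(c)`, every `j`, values in any real normed space. [cite: Balaban1984PropagatorsI, (1.18) p.20] -/
theorem norm_sq_bondAvgIter_le_bondAvgIter : ∀ (k : ℕ) (Y : VecField P 0 V) (c : PBond P k),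
    ‖bondAvgIter k Y c‖ ^ 2 ≤ bondAvgIter k (fun b => ‖Y b‖ ^ 2) c
  | 0, _, _ => le_rfl
  | k + 1, Y, c => by
    show ‖bondAvg (bondAvgIter k Y) c‖ ^ 2 ≤ bondAvg (bondAvgIter k (fun b => ‖Y b‖ ^ 2)) c
    calc ‖bondAvg (bondAvgIter k Y) c‖ ^ 2 ≤ (bondAvg (fun e => ‖bondAvgIter k Y e‖) c) ^ 2 :=
          pow_le_pow_left₀ (norm_nonneg _) (norm_bondAvg_le_bondAvg_norm _ c) 2
      _ ≤ bondAvg (fun e => ‖bondAvgIter k Y e‖ ^ 2) c := sq_bondAvg_le _ c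
      _ ≤ bondAvg (bondAvgIter k (fun b => ‖Y b‖ ^ 2)) c := bondAvg_mono (fun e => norm_sq_bondAvgIter_le_bondAvgIter k Y e) c

/-- ★★ **`Q_j` IS `ℓ²`-SMOOTHING**: `‖(Q_jY)(c)‖²·(L^d)^j ≤ Σ_b ‖Y_b‖²` (`j ≤ m + K`) — Jensen pointwise and the column mass `Σ_c (Q_jG)(c) = (L^d)^{−j}·Σ_b G_b` (`sum_bondAvgIter`).  In words: a datum of
size `1` at ONE `j`-bond costs at least `L^{dj∕2}` in the bond-`ℓ²` norm of any fine field whose straight average produces it. [cite: Balaban1984PropagatorsI, (1.18) p.20] -/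
theorem norm_sq_bondAvgIter_mul_le {k : ℕ} (hk : k ≤ P.m + P.K) (Y : VecField P 0 V) (c : PBond P k) :
    ‖bondAvgIter k Y c‖ ^ 2 * ((P.L : ℝ) ^ P.d) ^ k ≤ ∑ b : PBond P 0, ‖Y b‖ ^ 2 := by
  have hM : (0 : ℝ) < ((P.L : ℝ) ^ P.d) ^ k := by have := P.L_pos; positivity
  have h2 : bondAvgIter k (fun b => ‖Y b‖ ^ 2) c ≤ ∑ c' : PBond P k, bondAvgIter k (fun b => ‖Y b‖ ^ 2) c' :=
    Finset.single_le_sum (f := fun c' => bondAvgIter k (fun b => ‖Y b‖ ^ 2) c') (fun c' _ => bondAvgIter_nonneg k (fun b => sq_nonneg _) c') (Finset.mem_univ c)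
  rw [sum_bondAvgIter k hk (fun b => ‖Y b‖ ^ 2)] at h2
  have h4 : bondAvgIter k (fun b => ‖Y b‖ ^ 2) c * ((P.L : ℝ) ^ P.d) ^ k ≤ ∑ b : PBond P 0, ‖Y b‖ ^ 2 := by
    have := mul_le_mul_of_nonneg_right h2 hM.le
    rwa [mul_comm ((((P.L : ℝ) ^ P.d)⁻¹) ^ k), mul_assoc, inv_pow, inv_mul_cancel₀ hM.ne', mul_one] at this
  exact (mul_le_mul_of_nonneg_right (norm_sq_bondAvgIter_le_bondAvgIter k Y c) hM.le).trans h4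

end Smoothing

/-! ## §2  Around a plaquette the comb gradient of `Q^{(j)} = L^j·Q_j − dΛ_j` cancels -/

section Plaquette

variable {n : Type*} (Q : (i : ℕ) → (PBond P 0 → Matrix n n ℂ) → PBond P i → Matrix n n ℂ)
  (hQ0 : ∀ Y, Q 0 Y = Y) (hQs : ∀ (i : ℕ) (Y : PBond P 0 → Matrix n n ℂ) (c : PBond P (i + 1)), Q (i + 1) Y c = linAvg (Q i Y) c)

include hQ0 hQs in
/-- ★ **THE PLAQUETTE IDENTITY**: for every `linAvg`-family `Q^{(j)}` (`Q^{(0)} = id`, `Q^{(j+1)} = linAvg ∘ Q^{(j)}`; = `qLin j 1` on `𝔰𝔲(N)`-fields) the alternating sum of `Q^{(j)}Y`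
around a level-`j` plaquette `⟨x,μ⟩, ⟨x+e_μ,ν⟩, ⟨x+e_ν,μ⟩, ⟨x,ν⟩` is `L^j •` that of the straight `Q_jY` — the comb gradient `dΛ_j` of `linFamily_eq_sub_comb` sums to zero around the contour.
[cite: Balaban1985Averaging, (124)-(125) p.36, (62) p.28; Balaban1984PropagatorsI, (1.18) p.20] -/
theorem linFamily_plaquette {j : ℕ} (Y : PBond P 0 → Matrix n n ℂ) (x : Site P j) (μ ν : Fin P.d) :
    Q j Y ⟨x, μ⟩ + Q j Y ⟨x.shift μ, ν⟩ - Q j Y ⟨x.shift ν, μ⟩ - Q j Y ⟨x, ν⟩ =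
      (P.L ^ j : ℕ) • (bondAvgIter j Y ⟨x, μ⟩ + bondAvgIter j Y ⟨x.shift μ, ν⟩ - bondAvgIter j Y ⟨x.shift ν, μ⟩ - bondAvgIter j Y ⟨x, ν⟩) := by
  obtain ⟨Λ, hΛ0, hΛs⟩ := exists_combFamily (P := P) (n := n)
  rw [linFamily_eq_sub_comb Q hQ0 hQs Λ hΛ0 hΛs Y j ⟨x, μ⟩, linFamily_eq_sub_comb Q hQ0 hQs Λ hΛ0 hΛs Y j ⟨x.shift μ, ν⟩,
    linFamily_eq_sub_comb Q hQ0 hQs Λ hΛ0 hΛs Y j ⟨x.shift ν, μ⟩, linFamily_eq_sub_comb Q hQ0 hQs Λ hΛ0 hΛs Y j ⟨x, ν⟩]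
  simp only [PBond.tgt, Site.shift_comm x ν μ, smul_add, smul_sub]
  abel

end Plaquette

/-! ## §3  The floor, matrix-level core: four reproduced constraints around a plaquette -/

section Core

variable {N : ℕ} {ι : Type*} [Fintype ι]
variable (Q : (i : ℕ) → (PBond P 0 → Matrix (Fin N) (Fin N) ℂ) → PBond P i → Matrix (Fin N) (Fin N) ℂ)
  (hQ0 : ∀ Y, Q 0 Y = Y) (hQs : ∀ (i : ℕ) (Y : PBond P 0 → Matrix (Fin N) (Fin N) ℂ) (c : PBond P (i + 1)), Q (i + 1) Y c = linAvg (Q i Y) c)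

include hQ0 hQs in
/-- ★★ **THE LETTER FLOOR, CORE FORM**: if `Y : bonds → 𝔰𝔲(N)` reproduces through `Q^{(j)}` the values `v i₁ … v i₄` of a datum `v` at the four bonds of a level-`j` plaquette (`j ≤ m + K`)
and `p(Y) ≤ ρ‖v‖` for a seminorm `p ≥` bond-`ℓ²` (J-C's `hp`), then `‖↑(v i₁) + ↑(v i₂) − ↑(v i₃) − ↑(v i₄)‖²·(L^d)^j ≤ 16·(L²)^j·(ρ‖v‖)²` (§2, then §1 on each of the four straight averages).
[cite: Balaban1985Variational, (44)-(46) p.285; Balaban1984PropagatorsI, (1.18) p.20; Balaban1985Averaging, (124)-(125) p.36] -/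
theorem letter_floor_of_reproduce {j : ℕ} (hj : j ≤ P.m + P.K) (x : Site P j) (μ ν : Fin P.d)
    (p : Seminorm ℝ (PBond P 0 → lieSU (Fin N))) (hp : ∀ Y : PBond P 0 → lieSU (Fin N), ∑ b, ‖(Y b : Matrix (Fin N) (Fin N) ℂ)‖ ^ 2 ≤ p Y ^ 2)
    (Y : PBond P 0 → lieSU (Fin N)) (v : ι → lieSU (Fin N)) (i₁ i₂ i₃ i₄ : ι)
    (h₁ : Q j (fun b => (Y b : Matrix (Fin N) (Fin N) ℂ)) ⟨x, μ⟩ = (v i₁ : Matrix (Fin N) (Fin N) ℂ))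
    (h₂ : Q j (fun b => (Y b : Matrix (Fin N) (Fin N) ℂ)) ⟨x.shift μ, ν⟩ = (v i₂ : Matrix (Fin N) (Fin N) ℂ))
    (h₃ : Q j (fun b => (Y b : Matrix (Fin N) (Fin N) ℂ)) ⟨x.shift ν, μ⟩ = (v i₃ : Matrix (Fin N) (Fin N) ℂ))
    (h₄ : Q j (fun b => (Y b : Matrix (Fin N) (Fin N) ℂ)) ⟨x, ν⟩ = (v i₄ : Matrix (Fin N) (Fin N) ℂ))
    {ρ : ℝ} (hY : p Y ≤ ρ * ‖v‖) :
    ‖(v i₁ : Matrix (Fin N) (Fin N) ℂ) + v i₂ - v i₃ - v i₄‖ ^ 2 * ((P.L : ℝ) ^ P.d) ^ j ≤ 16 * ((P.L : ℝ) ^ 2) ^ j * (ρ * ‖v‖) ^ 2 := by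
  set Yb : PBond P 0 → Matrix (Fin N) (Fin N) ℂ := fun b => (Y b : Matrix (Fin N) (Fin N) ℂ) with hYb
  set M : ℝ := ((P.L : ℝ) ^ P.d) ^ j with hMdef
  have hM : 0 < M := by have := P.L_pos; positivity
  set T : ℝ := ∑ b, ‖Yb b‖ ^ 2 with hT
  have hT0 : 0 ≤ T := Finset.sum_nonneg fun b _ => sq_nonneg _
  have hTle : T ≤ (ρ * ‖v‖) ^ 2 := (hp Y).trans (pow_le_pow_left₀ (apply_nonneg p Y) hY 2)
  -- each straight average has `‖·‖²·M ≤ T`, hence `‖·‖ ≤ r := √(T∕M)`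
  set r : ℝ := Real.sqrt (T / M) with hr
  have hrsq : r ^ 2 = T / M := Real.sq_sqrt (div_nonneg hT0 hM.le)
  have hQr : ∀ c : PBond P j, ‖bondAvgIter j Yb c‖ ≤ r := fun c => by
    have h : ‖bondAvgIter j Yb c‖ ^ 2 ≤ T / M := by rw [le_div_iff₀ hM]; exact norm_sq_bondAvgIter_mul_le hj Yb c
    calc ‖bondAvgIter j Yb c‖ = |‖bondAvgIter j Yb c‖| := (abs_of_nonneg (norm_nonneg _)).symm
      _ ≤ Real.sqrt (T / M) := Real.abs_le_sqrt h
  -- the alternating sum is `L^j •` the straight one (§2)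
  have hpl := linFamily_plaquette Q hQ0 hQs Yb x μ ν
  rw [h₁, h₂, h₃, h₄] at hpl
  have hnorm : ‖(v i₁ : Matrix (Fin N) (Fin N) ℂ) + v i₂ - v i₃ - v i₄‖ ≤ (P.L : ℝ) ^ j * (4 * r) := by
    rw [hpl, ← Nat.cast_smul_eq_nsmul ℝ, norm_smul, Real.norm_natCast]
    push_cast
    refine mul_le_mul_of_nonneg_left ?_ (by positivity)
    calc ‖bondAvgIter j Yb ⟨x, μ⟩ + bondAvgIter j Yb ⟨x.shift μ, ν⟩ - bondAvgIter j Yb ⟨x.shift ν, μ⟩ - bondAvgIter j Yb ⟨x, ν⟩‖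
        ≤ ‖bondAvgIter j Yb ⟨x, μ⟩‖ + ‖bondAvgIter j Yb ⟨x.shift μ, ν⟩‖ + ‖bondAvgIter j Yb ⟨x.shift ν, μ⟩‖ + ‖bondAvgIter j Yb ⟨x, ν⟩‖ :=
          (norm_sub_le _ _).trans (add_le_add ((norm_sub_le _ _).trans (add_le_add (norm_add_le _ _) le_rfl)) le_rfl)
      _ ≤ r + r + r + r := add_le_add (add_le_add (add_le_add (hQr _) (hQr _)) (hQr _)) (hQr _)
      _ = 4 * r := by ring
  calc ‖(v i₁ : Matrix (Fin N) (Fin N) ℂ) + v i₂ - v i₃ - v i₄‖ ^ 2 * M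
      ≤ ((P.L : ℝ) ^ j * (4 * r)) ^ 2 * M := mul_le_mul_of_nonneg_right (pow_le_pow_left₀ (norm_nonneg _) hnorm 2) hM.le
    _ = 16 * ((P.L : ℝ) ^ 2) ^ j * (r ^ 2 * M) := by rw [← pow_mul, mul_comm 2 j, pow_mul]; ring
    _ = 16 * ((P.L : ℝ) ^ 2) ^ j * T := by rw [hrsq, div_mul_cancel₀ T hM.ne']
    _ ≤ 16 * ((P.L : ℝ) ^ 2) ^ j * (ρ * ‖v‖) ^ 2 := mul_le_mul_of_nonneg_left hTle (by positivity)

include hQ0 hQs in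
/-- ★★ **THE LETTER FLOOR, CORE FORM, TEST DATUM `δ_{i₁}·E`**: for a WHOLE map `Rf : (ι → 𝔰𝔲(N)) → (bonds → 𝔰𝔲(N))` reproducing the four constraints of every datum, `p(Rf v) ≤ ρ‖v‖` for
all `v`, and `i₂, i₃, i₄ ≠ i₁`: for every `E ∈ 𝔰𝔲(N)`, `(L^d)^j·‖↑E‖² ≤ 16·(L²)^j·ρ²·‖E‖²` (left: the OPERATOR norm of J-C's `hp`; right: `𝔰𝔲(N)`'s pinned Hilbert–Schmidt norm of the sup `q`;
`‖E‖_HS ≤ √N·‖↑E‖_op`, so `ρ ≥ L^{(d−2)j∕2}∕(4√N)`). [cite: Balaban1985Variational, (44)-(46) p.285; Balaban1985Averaging, (17)-(19) p.21; Balaban1984PropagatorsI, (1.18) p.20] -/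
theorem letter_floor_of_reproduce_single [DecidableEq ι] {j : ℕ} (hj : j ≤ P.m + P.K) (x : Site P j) (μ ν : Fin P.d)
    (p : Seminorm ℝ (PBond P 0 → lieSU (Fin N))) (hp : ∀ Y : PBond P 0 → lieSU (Fin N), ∑ b, ‖(Y b : Matrix (Fin N) (Fin N) ℂ)‖ ^ 2 ≤ p Y ^ 2)
    (Rf : (ι → lieSU (Fin N)) → PBond P 0 → lieSU (Fin N)) (i₁ i₂ i₃ i₄ : ι) (h₂₁ : i₂ ≠ i₁) (h₃₁ : i₃ ≠ i₁) (h₄₁ : i₄ ≠ i₁)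
    (h₁ : ∀ v, Q j (fun b => (Rf v b : Matrix (Fin N) (Fin N) ℂ)) ⟨x, μ⟩ = (v i₁ : Matrix (Fin N) (Fin N) ℂ))
    (h₂ : ∀ v, Q j (fun b => (Rf v b : Matrix (Fin N) (Fin N) ℂ)) ⟨x.shift μ, ν⟩ = (v i₂ : Matrix (Fin N) (Fin N) ℂ))
    (h₃ : ∀ v, Q j (fun b => (Rf v b : Matrix (Fin N) (Fin N) ℂ)) ⟨x.shift ν, μ⟩ = (v i₃ : Matrix (Fin N) (Fin N) ℂ))
    (h₄ : ∀ v, Q j (fun b => (Rf v b : Matrix (Fin N) (Fin N) ℂ)) ⟨x, ν⟩ = (v i₄ : Matrix (Fin N) (Fin N) ℂ))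
    {ρ : ℝ} (hρ : ∀ v, p (Rf v) ≤ ρ * ‖v‖) (E : lieSU (Fin N)) :
    ((P.L : ℝ) ^ P.d) ^ j * ‖(E : Matrix (Fin N) (Fin N) ℂ)‖ ^ 2 ≤ 16 * ((P.L : ℝ) ^ 2) ^ j * ρ ^ 2 * ‖E‖ ^ 2 := by
  set v : ι → lieSU (Fin N) := Pi.single i₁ E with hv
  have hmain := letter_floor_of_reproduce Q hQ0 hQs hj x μ ν p hp (Rf v) v i₁ i₂ i₃ i₄ (h₁ v) (h₂ v) (h₃ v) (h₄ v) (hρ v)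
  have hv₁ : v i₁ = E := by simp [hv]
  have hv₂ : v i₂ = 0 := by simp [hv, Pi.single_eq_of_ne h₂₁]
  have hv₃ : v i₃ = 0 := by simp [hv, Pi.single_eq_of_ne h₃₁]
  have hv₄ : v i₄ = 0 := by simp [hv, Pi.single_eq_of_ne h₄₁]
  have hvn : ‖v‖ = ‖E‖ := by rw [hv, Pi.norm_single]
  rw [hv₁, hv₂, hv₃, hv₄, hvn] at hmain
  simp only [ZeroMemClass.coe_zero, add_zero, sub_zero] at hmain
  calc ((P.L : ℝ) ^ P.d) ^ j * ‖(E : Matrix (Fin N) (Fin N) ℂ)‖ ^ 2 = ‖(E : Matrix (Fin N) (Fin N) ℂ)‖ ^ 2 * ((P.L : ℝ) ^ P.d) ^ j := mul_comm _ _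
    _ ≤ 16 * ((P.L : ℝ) ^ 2) ^ j * (ρ * ‖E‖) ^ 2 := hmain
    _ = 16 * ((P.L : ℝ) ^ 2) ^ j * ρ ^ 2 * ‖E‖ ^ 2 := by ring

end Core

/-! ## §4  The floor in the two currencies of record: module F ∕ H3 (`π ∘ qLin j 1` on `constrEnum 𝔹 k`) and J-C (`Lf := fderiv ℝ (msChart … (M˙1) 1) 0`) -/

section Record

variable {N : ℕ} [NeZero N]

omit [NeZero N] in
/-- **Exchange rate of the two norms of `𝔰𝔲(N)`**: the pinned Hilbert–Schmidt norm (17) is at most `√N`× the operator norm (19), `‖E‖² ≤ N·‖↑E‖²` (column by column,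
`MatrixNorms.sum_norm_sq_col_le_opNorm_sq`; the converse of n12-w2's `opNorm_coe_le_norm_lieSU`). [cite: Balaban1985Averaging, (17) p.20, (19) p.21] -/
theorem norm_sq_lieSU_le_card_mul_opNorm_sq (E : lieSU (Fin N)) : ‖E‖ ^ 2 ≤ (N : ℝ) * ‖(E : Matrix (Fin N) (Fin N) ℂ)‖ ^ 2 := by
  have h1 : ‖E‖ ^ 2 = (Matrix.trace (star (E : Matrix (Fin N) (Fin N) ℂ) * (E : Matrix (Fin N) (Fin N) ℂ))).re := by
    rw [← real_inner_self_eq_norm_sq]; rfl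
  rw [h1, Matrix.star_eq_conjTranspose, ← MatrixNorms.sum_norm_sq_eq_re_trace, Finset.sum_comm]
  calc ∑ j, ∑ i, ‖(E : Matrix (Fin N) (Fin N) ℂ) i j‖ ^ 2 ≤ ∑ _j : Fin N, ‖(E : Matrix (Fin N) (Fin N) ℂ)‖ ^ 2 :=
        Finset.sum_le_sum fun j _ => MatrixNorms.sum_norm_sq_col_le_opNorm_sq _ j
    _ = (N : ℝ) * ‖(E : Matrix (Fin N) (Fin N) ℂ)‖ ^ 2 := by rw [Finset.sum_const, Finset.card_univ, Fintype.card_fin, nsmul_eq_mul]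

/-- From module F's flat currency to the matrix-level reproduction: `π(qLin j 1 Y c) = w` with `Y` `𝔰𝔲(N)`-valued gives `Q^{(j)}↑Y(c) = ↑w` for every `linAvg`-family `Q` (`qLin_one_eq_family`,
`iterLin_mem_lieSU`, `coe_suProj_of_mem`). [cite: Balaban1985Variational, (44)-(47) p.285; Balaban1985Averaging, (124)-(125) p.36] -/
theorem reproduce_of_qLin (Q : (i : ℕ) → (PBond P 0 → Matrix (Fin N) (Fin N) ℂ) → PBond P i → Matrix (Fin N) (Fin N) ℂ) (hQ0 : ∀ Y, Q 0 Y = Y)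
    (hQs : ∀ (i : ℕ) (Y : PBond P 0 → Matrix (Fin N) (Fin N) ℂ) (c : PBond P (i + 1)), Q (i + 1) Y c = linAvg (Q i Y) c)
    {j : ℕ} (Y : PBond P 0 → lieSU (Fin N)) (c : PBond P j) (w : lieSU (Fin N)) (h : suProj N (qLin j (1 : GaugeField P 0 (SU N)) Y c) = w) :
    Q j (fun b => (Y b : Matrix (Fin N) (Fin N) ℂ)) c = (w : Matrix (Fin N) (Fin N) ℂ) := by
  have hmem : Q j (fun b => (Y b : Matrix (Fin N) (Fin N) ℂ)) c ∈ lieSU (Fin N) := iterLin_mem_lieSU Q hQ0 hQs (fun b => (Y b).2) _ _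
  rw [qLin_one_eq_family Q hQ0 hQs] at h
  rw [← h, coe_suProj_of_mem hmem]

/-- Distinct bonds of one level give distinct enumerated rows. [cite: Balaban1988Convergent, (2.2) p.255 (bookkeeping)] -/
theorem constrEnum_ne_of_ne (𝔹 : DetSet P) {k : ℕ} {j : Fin (k + 1)} {c c' : {c : PBond P j // c ∈ bondsOf (𝔹 j)}} (h : c.1 ≠ c'.1) :
    constrEnum 𝔹 k ⟨j, c⟩ ≠ constrEnum 𝔹 k ⟨j, c'⟩ := by
  intro hab
  have h1 := (constrEnum 𝔹 k).injective hab
  rw [Sigma.mk.inj_iff] at h1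
  exact h (congrArg Subtype.val (eq_of_heq h1.2))

/-- ★★★ **THE LETTER FLOOR IN MODULE F's FLAT CURRENCY**: rows `bondsOf (𝔹 j)` containing the four bonds of a level-`j` plaquette (`j ≤ k`, `j ≤ m + K`); ANY map `Rf` with
`π(qLin j_i 1 (Rf v) c_i) = v i` on the enumerated rows (module F's `h₁`, H3's right inverse, or any other); ANY seminorm `p ≥` bond-`ℓ²` with `p(Rf v) ≤ ρ‖v‖` (`q =` sup).  Then for every `v`:
`‖↑(v i₁) + ↑(v i₂) − ↑(v i₃) − ↑(v i₄)‖²·(L^d)^j ≤ 16·(L²)^j·(ρ‖v‖)²`. [cite: Balaban1985Variational, (44)-(46) p.285; Balaban1988Convergent, (2.10)-(2.12) p.256; Balaban1984PropagatorsI, (1.18) p.20] -/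
theorem letter_floor_qLin (𝔹 : DetSet P) {k j : ℕ} (hjk : j ≤ k) (hj : j ≤ P.m + P.K) (x : Site P j) (μ ν : Fin P.d)
    (hm₁ : (⟨x, μ⟩ : PBond P j) ∈ bondsOf (𝔹 j)) (hm₂ : (⟨x.shift μ, ν⟩ : PBond P j) ∈ bondsOf (𝔹 j))
    (hm₃ : (⟨x.shift ν, μ⟩ : PBond P j) ∈ bondsOf (𝔹 j)) (hm₄ : (⟨x, ν⟩ : PBond P j) ∈ bondsOf (𝔹 j))
    (p : Seminorm ℝ (PBond P 0 → lieSU (Fin N))) (hp : ∀ Y : PBond P 0 → lieSU (Fin N), ∑ b, ‖(Y b : Matrix (Fin N) (Fin N) ℂ)‖ ^ 2 ≤ p Y ^ 2)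
    (Rf : (Fin (constrCard 𝔹 k) → lieSU (Fin N)) → PBond P 0 → lieSU (Fin N))
    (hRf : ∀ v i, suProj N (qLin (((constrEnum 𝔹 k).symm i).1 : ℕ) (1 : GaugeField P 0 (SU N)) (Rf v) ((constrEnum 𝔹 k).symm i).2.1) = v i)
    {ρ : ℝ} (hρ : ∀ v, p (Rf v) ≤ ρ * ‖v‖) (v : Fin (constrCard 𝔹 k) → lieSU (Fin N)) :
    ‖(v (constrEnum 𝔹 k ⟨⟨j, Nat.lt_succ_of_le hjk⟩, ⟨x, μ⟩, hm₁⟩) : Matrix (Fin N) (Fin N) ℂ) + v (constrEnum 𝔹 k ⟨⟨j, Nat.lt_succ_of_le hjk⟩, ⟨x.shift μ, ν⟩, hm₂⟩)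
        - v (constrEnum 𝔹 k ⟨⟨j, Nat.lt_succ_of_le hjk⟩, ⟨x.shift ν, μ⟩, hm₃⟩) - v (constrEnum 𝔹 k ⟨⟨j, Nat.lt_succ_of_le hjk⟩, ⟨x, ν⟩, hm₄⟩)‖ ^ 2 * ((P.L : ℝ) ^ P.d) ^ j
      ≤ 16 * ((P.L : ℝ) ^ 2) ^ j * (ρ * ‖v‖) ^ 2 := by
  obtain ⟨Q, hQ0, hQs⟩ := exists_linFamily (P := P) (n := Fin N)
  have key : ∀ idx : ConstrSet 𝔹 k, Q (idx.1 : ℕ) (fun b => (Rf v b : Matrix (Fin N) (Fin N) ℂ)) idx.2.1 = (v (constrEnum 𝔹 k idx) : Matrix (Fin N) (Fin N) ℂ) := by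
    intro idx
    have h := hRf v (constrEnum 𝔹 k idx)
    rw [Equiv.symm_apply_apply] at h
    exact reproduce_of_qLin Q hQ0 hQs (Rf v) _ _ h
  exact letter_floor_of_reproduce Q hQ0 hQs hj x μ ν p hp (Rf v) v _ _ _ _
    (key ⟨⟨j, Nat.lt_succ_of_le hjk⟩, ⟨x, μ⟩, hm₁⟩) (key ⟨⟨j, Nat.lt_succ_of_le hjk⟩, ⟨x.shift μ, ν⟩, hm₂⟩)
    (key ⟨⟨j, Nat.lt_succ_of_le hjk⟩, ⟨x.shift ν, μ⟩, hm₃⟩) (key ⟨⟨j, Nat.lt_succ_of_le hjk⟩, ⟨x, ν⟩, hm₄⟩) (hρ v)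

variable {F : T4Family} {K : ℕ}

/-- ★★★ **THE LETTER FLOOR IN J-C's CURRENCY** (`Lf := fderiv ℝ (msChart F N K k 𝔹 (M˙1) 1) 0`, `hRf : Lf (Rf v) = v`; module B `iterLin_eq_of_rightInverse` gives the matrix-level
reproduction): rows of `𝔹` containing a level-`j` plaquette (`j ≤ k`, `j ≤ m + K`), `p ≥` bond-`ℓ²`, `p(Rf v) ≤ ρ‖v‖` ⟹ `‖↑(v i₁) + ↑(v i₂) − ↑(v i₃) − ↑(v i₄)‖²·(L^d)^j ≤ 16·(L²)^j·(ρ‖v‖)²`.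
[cite: Balaban1985Variational, (44)-(48) p.285, (82)-(83) p.290; Balaban1988Convergent, (2.10)-(2.12) p.256; Balaban1984PropagatorsI, (1.18) p.20] -/
theorem letter_floor_fderiv_msChart_one {k : ℕ} (𝔹 : DetSet (F.P K)) {j : ℕ} (hjk : j ≤ k) (hj : j ≤ (F.P K).m + (F.P K).K) (x : Site (F.P K) j) (μ ν : Fin (F.P K).d)
    (hm₁ : (⟨x, μ⟩ : PBond (F.P K) j) ∈ bondsOf (𝔹 j)) (hm₂ : (⟨x.shift μ, ν⟩ : PBond (F.P K) j) ∈ bondsOf (𝔹 j))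
    (hm₃ : (⟨x.shift ν, μ⟩ : PBond (F.P K) j) ∈ bondsOf (𝔹 j)) (hm₄ : (⟨x, ν⟩ : PBond (F.P K) j) ∈ bondsOf (𝔹 j))
    (p : Seminorm ℝ (PBond (F.P K) 0 → lieSU (Fin N))) (hp : ∀ Y : PBond (F.P K) 0 → lieSU (Fin N), ∑ b, ‖(Y b : Matrix (Fin N) (Fin N) ℂ)‖ ^ 2 ≤ p Y ^ 2)
    (Rf : (Fin (constrCard 𝔹 k) → lieSU (Fin N)) → PBond (F.P K) 0 → lieSU (Fin N))
    (hRf : ∀ v, fderiv ℝ (msChart F N K k 𝔹 (avgFamily (avOfRecord F N K) (1 : GaugeField (F.P K) 0 (SU N))) (1 : GaugeField (F.P K) 0 (SU N))) 0 (Rf v) = v)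
    {ρ : ℝ} (hρ : ∀ v, p (Rf v) ≤ ρ * ‖v‖) (v : Fin (constrCard 𝔹 k) → lieSU (Fin N)) :
    ‖(v (constrEnum 𝔹 k ⟨⟨j, Nat.lt_succ_of_le hjk⟩, ⟨x, μ⟩, hm₁⟩) : Matrix (Fin N) (Fin N) ℂ) + v (constrEnum 𝔹 k ⟨⟨j, Nat.lt_succ_of_le hjk⟩, ⟨x.shift μ, ν⟩, hm₂⟩)
        - v (constrEnum 𝔹 k ⟨⟨j, Nat.lt_succ_of_le hjk⟩, ⟨x.shift ν, μ⟩, hm₃⟩) - v (constrEnum 𝔹 k ⟨⟨j, Nat.lt_succ_of_le hjk⟩, ⟨x, ν⟩, hm₄⟩)‖ ^ 2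
          * (((F.P K).L : ℝ) ^ (F.P K).d) ^ j
      ≤ 16 * (((F.P K).L : ℝ) ^ 2) ^ j * (ρ * ‖v‖) ^ 2 := by
  obtain ⟨Q, hQ0, hQs⟩ := exists_linFamily (P := F.P K) (n := Fin N)
  have key : ∀ idx : ConstrSet 𝔹 k, Q (idx.1 : ℕ) (fun b => (Rf v b : Matrix (Fin N) (Fin N) ℂ)) idx.2.1 = (v (constrEnum 𝔹 k idx) : Matrix (Fin N) (Fin N) ℂ) := by
    intro idx
    have h := iterLin_eq_of_rightInverse (F := F) (N := N) (K := K) (k := k) Q hQ0 hQs 𝔹 Rf hRf v (constrEnum 𝔹 k idx)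
    rwa [Equiv.symm_apply_apply] at h
  exact letter_floor_of_reproduce Q hQ0 hQs hj x μ ν p hp (Rf v) v _ _ _ _
    (key ⟨⟨j, Nat.lt_succ_of_le hjk⟩, ⟨x, μ⟩, hm₁⟩) (key ⟨⟨j, Nat.lt_succ_of_le hjk⟩, ⟨x.shift μ, ν⟩, hm₂⟩)
    (key ⟨⟨j, Nat.lt_succ_of_le hjk⟩, ⟨x.shift ν, μ⟩, hm₃⟩) (key ⟨⟨j, Nat.lt_succ_of_le hjk⟩, ⟨x, ν⟩, hm₄⟩) (hρ v)

/-- ★★★ **J-C's CURRENCY, TEST DATUM `δ_{i₁}·E`**: with `μ ≠ ν` and `x + e_ν ≠ x`, every right inverse `Rf` of `fderiv ℝ (msChart F N K k 𝔹 (M˙1) 1) 0` with `p(Rf v) ≤ ρ‖v‖` has, for every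
`E ∈ 𝔰𝔲(N)`, `(L^d)^j·‖↑E‖²_op ≤ 16·(L²)^j·ρ²·‖E‖²_HS`. [cite: Balaban1985Variational, (44)-(48) p.285, (82)-(83) p.290; Balaban1988Convergent, (2.10)-(2.12) p.256; Balaban1989LargeFieldII, (1.11)-(1.13) p.359] -/
theorem letter_floor_fderiv_msChart_one_single {k : ℕ} (𝔹 : DetSet (F.P K)) {j : ℕ} (hjk : j ≤ k) (hj : j ≤ (F.P K).m + (F.P K).K) (x : Site (F.P K) j) {μ ν : Fin (F.P K).d}
    (hμν : μ ≠ ν) (hx : x.shift ν ≠ x)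
    (hm₁ : (⟨x, μ⟩ : PBond (F.P K) j) ∈ bondsOf (𝔹 j)) (hm₂ : (⟨x.shift μ, ν⟩ : PBond (F.P K) j) ∈ bondsOf (𝔹 j))
    (hm₃ : (⟨x.shift ν, μ⟩ : PBond (F.P K) j) ∈ bondsOf (𝔹 j)) (hm₄ : (⟨x, ν⟩ : PBond (F.P K) j) ∈ bondsOf (𝔹 j))
    (p : Seminorm ℝ (PBond (F.P K) 0 → lieSU (Fin N))) (hp : ∀ Y : PBond (F.P K) 0 → lieSU (Fin N), ∑ b, ‖(Y b : Matrix (Fin N) (Fin N) ℂ)‖ ^ 2 ≤ p Y ^ 2)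
    (Rf : (Fin (constrCard 𝔹 k) → lieSU (Fin N)) → PBond (F.P K) 0 → lieSU (Fin N))
    (hRf : ∀ v, fderiv ℝ (msChart F N K k 𝔹 (avgFamily (avOfRecord F N K) (1 : GaugeField (F.P K) 0 (SU N))) (1 : GaugeField (F.P K) 0 (SU N))) 0 (Rf v) = v)
    {ρ : ℝ} (hρ : ∀ v, p (Rf v) ≤ ρ * ‖v‖) (E : lieSU (Fin N)) :
    (((F.P K).L : ℝ) ^ (F.P K).d) ^ j * ‖(E : Matrix (Fin N) (Fin N) ℂ)‖ ^ 2 ≤ 16 * (((F.P K).L : ℝ) ^ 2) ^ j * ρ ^ 2 * ‖E‖ ^ 2 := by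
  obtain ⟨Q, hQ0, hQs⟩ := exists_linFamily (P := F.P K) (n := Fin N)
  have key : ∀ (v : Fin (constrCard 𝔹 k) → lieSU (Fin N)) (idx : ConstrSet 𝔹 k),
      Q (idx.1 : ℕ) (fun b => (Rf v b : Matrix (Fin N) (Fin N) ℂ)) idx.2.1 = (v (constrEnum 𝔹 k idx) : Matrix (Fin N) (Fin N) ℂ) := by
    intro v idx
    have h := iterLin_eq_of_rightInverse (F := F) (N := N) (K := K) (k := k) Q hQ0 hQs 𝔹 Rf hRf v (constrEnum 𝔹 k idx)
    rwa [Equiv.symm_apply_apply] at h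
  exact letter_floor_of_reproduce_single Q hQ0 hQs hj x μ ν p hp Rf
    (constrEnum 𝔹 k ⟨⟨j, Nat.lt_succ_of_le hjk⟩, ⟨x, μ⟩, hm₁⟩) (constrEnum 𝔹 k ⟨⟨j, Nat.lt_succ_of_le hjk⟩, ⟨x.shift μ, ν⟩, hm₂⟩)
    (constrEnum 𝔹 k ⟨⟨j, Nat.lt_succ_of_le hjk⟩, ⟨x.shift ν, μ⟩, hm₃⟩) (constrEnum 𝔹 k ⟨⟨j, Nat.lt_succ_of_le hjk⟩, ⟨x, ν⟩, hm₄⟩)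
    (constrEnum_ne_of_ne 𝔹 (j := ⟨j, Nat.lt_succ_of_le hjk⟩) (c := ⟨⟨x.shift μ, ν⟩, hm₂⟩) (c' := ⟨⟨x, μ⟩, hm₁⟩) fun h => hμν (congrArg PBond.dir h).symm)
    (constrEnum_ne_of_ne 𝔹 (j := ⟨j, Nat.lt_succ_of_le hjk⟩) (c := ⟨⟨x.shift ν, μ⟩, hm₃⟩) (c' := ⟨⟨x, μ⟩, hm₁⟩) fun h => hx (congrArg PBond.src h))
    (constrEnum_ne_of_ne 𝔹 (j := ⟨j, Nat.lt_succ_of_le hjk⟩) (c := ⟨⟨x, ν⟩, hm₄⟩) (c' := ⟨⟨x, μ⟩, hm₁⟩) fun h => hμν (congrArg PBond.dir h).symm)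
    (fun v => key v ⟨⟨j, Nat.lt_succ_of_le hjk⟩, ⟨x, μ⟩, hm₁⟩) (fun v => key v ⟨⟨j, Nat.lt_succ_of_le hjk⟩, ⟨x.shift μ, ν⟩, hm₂⟩)
    (fun v => key v ⟨⟨j, Nat.lt_succ_of_le hjk⟩, ⟨x.shift ν, μ⟩, hm₃⟩) (fun v => key v ⟨⟨j, Nat.lt_succ_of_le hjk⟩, ⟨x, ν⟩, hm₄⟩) hρ E

/-- ★★★ **AT THE RECORD's `𝐁_k(Z) = Bj M₁ Z k`, DEEPEST LEVEL** (`Bj_top`: the level-`k` rows are the `k`-bonds meeting `Ω_k^{(k)}`, `Ω_k = maxDomT M₁ Z k`): if the corners `x`, `x+e_μ`,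
`x+e_ν` of a unit square of `k`-sites have their centres in `Ω_k` (`μ ≠ ν`, `x + e_ν ≠ x`), every right inverse `Rf` of J-C's `Lf` at `Bj M₁ Z k` with `p(Rf v) ≤ ρ‖v‖` has
`(L^d)^k·‖↑E‖²_op ≤ 16·(L²)^k·ρ²·‖E‖²_HS` for every `E ∈ 𝔰𝔲(N)`. [cite: Balaban1988Convergent, (2.13) pp.256-257, (2.10)-(2.12) p.256; Balaban1985Variational, (44)-(48) p.285; Balaban1989LargeFieldII, (1.11)-(1.13) p.359] -/
theorem letter_floor_fderiv_msChart_one_Bj_single {k M₁ : ℕ} {Z : Set (Site (F.P K) 0)} (hk : k ≤ (F.P K).m + (F.P K).K) (x : Site (F.P K) k) {μ ν : Fin (F.P K).d}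
    (hμν : μ ≠ ν) (hx : x.shift ν ≠ x) (h₀ : embIter k x ∈ maxDomT M₁ Z k) (hμ : embIter k (x.shift μ) ∈ maxDomT M₁ Z k) (hν : embIter k (x.shift ν) ∈ maxDomT M₁ Z k)
    (p : Seminorm ℝ (PBond (F.P K) 0 → lieSU (Fin N))) (hp : ∀ Y : PBond (F.P K) 0 → lieSU (Fin N), ∑ b, ‖(Y b : Matrix (Fin N) (Fin N) ℂ)‖ ^ 2 ≤ p Y ^ 2)
    (Rf : (Fin (constrCard (Bj M₁ Z k : DetSet (F.P K)) k) → lieSU (Fin N)) → PBond (F.P K) 0 → lieSU (Fin N))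
    (hRf : ∀ v, fderiv ℝ (msChart F N K k (Bj M₁ Z k) (avgFamily (avOfRecord F N K) (1 : GaugeField (F.P K) 0 (SU N))) (1 : GaugeField (F.P K) 0 (SU N))) 0 (Rf v) = v)
    {ρ : ℝ} (hρ : ∀ v, p (Rf v) ≤ ρ * ‖v‖) (E : lieSU (Fin N)) :
    (((F.P K).L : ℝ) ^ (F.P K).d) ^ k * ‖(E : Matrix (Fin N) (Fin N) ℂ)‖ ^ 2 ≤ 16 * (((F.P K).L : ℝ) ^ 2) ^ k * ρ ^ 2 * ‖E‖ ^ 2 := by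
  have hrow : ∀ c : PBond (F.P K) k, embIter k c.src ∈ maxDomT M₁ Z k → c ∈ bondsOf ((Bj M₁ Z k : DetSet (F.P K)) k) := fun c hc => by
    rw [Bj_top]; exact Or.inl hc
  exact letter_floor_fderiv_msChart_one_single (Bj M₁ Z k) le_rfl hk x hμν hx (hrow ⟨x, μ⟩ h₀) (hrow ⟨x.shift μ, ν⟩ hμ) (hrow ⟨x.shift ν, μ⟩ hν)
    (hrow ⟨x, ν⟩ h₀) p hp Rf hRf hρ E

/-- ★★★ **THE FLOOR AS A NUMBER AT `𝐁_k(Z)`**: under the hypotheses of `letter_floor_fderiv_msChart_one_Bj_single` and ONE non-zero `E ∈ 𝔰𝔲(N)` (`2 ≤ N`): `(L^d)^k ≤ 16·N·(L²)^k·ρ²`, i.e.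
**`ρ ≥ L^{(d−2)k∕2}∕(4√N)`** — at `d = 4`, `N = 2`: `ρc ≥ L^k∕(4√2)` for every right inverse of J-C's flat `Lf` in the (`p ≥` bond-`ℓ²`, `q =` sup) currency.
[cite: Balaban1988Convergent, (2.13) pp.256-257; Balaban1985Variational, (44)-(48) p.285; Balaban1985Averaging, (17)-(19) p.21; Balaban1989LargeFieldII, (1.11)-(1.13) p.359] -/
theorem letter_floor_fderiv_msChart_one_Bj_numeral {k M₁ : ℕ} {Z : Set (Site (F.P K) 0)} (hk : k ≤ (F.P K).m + (F.P K).K) (x : Site (F.P K) k) {μ ν : Fin (F.P K).d}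
    (hμν : μ ≠ ν) (hx : x.shift ν ≠ x) (h₀ : embIter k x ∈ maxDomT M₁ Z k) (hμ : embIter k (x.shift μ) ∈ maxDomT M₁ Z k) (hν : embIter k (x.shift ν) ∈ maxDomT M₁ Z k)
    (p : Seminorm ℝ (PBond (F.P K) 0 → lieSU (Fin N))) (hp : ∀ Y : PBond (F.P K) 0 → lieSU (Fin N), ∑ b, ‖(Y b : Matrix (Fin N) (Fin N) ℂ)‖ ^ 2 ≤ p Y ^ 2)
    (Rf : (Fin (constrCard (Bj M₁ Z k : DetSet (F.P K)) k) → lieSU (Fin N)) → PBond (F.P K) 0 → lieSU (Fin N))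
    (hRf : ∀ v, fderiv ℝ (msChart F N K k (Bj M₁ Z k) (avgFamily (avOfRecord F N K) (1 : GaugeField (F.P K) 0 (SU N))) (1 : GaugeField (F.P K) 0 (SU N))) 0 (Rf v) = v)
    {ρ : ℝ} (hρ : ∀ v, p (Rf v) ≤ ρ * ‖v‖) {E : lieSU (Fin N)} (hE : E ≠ 0) :
    (((F.P K).L : ℝ) ^ (F.P K).d) ^ k ≤ 16 * (N : ℝ) * (((F.P K).L : ℝ) ^ 2) ^ k * ρ ^ 2 := by
  have h := letter_floor_fderiv_msChart_one_Bj_single hk x hμν hx h₀ hμ hν p hp Rf hRf hρ E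
  have hEx := norm_sq_lieSU_le_card_mul_opNorm_sq E
  have hE' : (E : Matrix (Fin N) (Fin N) ℂ) ≠ 0 := fun h0 => hE (Subtype.ext h0)
  have hpos : 0 < ‖(E : Matrix (Fin N) (Fin N) ℂ)‖ ^ 2 := by positivity
  have h2 : (((F.P K).L : ℝ) ^ (F.P K).d) ^ k * ‖(E : Matrix (Fin N) (Fin N) ℂ)‖ ^ 2 ≤ (16 * (N : ℝ) * (((F.P K).L : ℝ) ^ 2) ^ k * ρ ^ 2) * ‖(E : Matrix (Fin N) (Fin N) ℂ)‖ ^ 2 :=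
    h.trans (by
      calc 16 * (((F.P K).L : ℝ) ^ 2) ^ k * ρ ^ 2 * ‖E‖ ^ 2 ≤ 16 * (((F.P K).L : ℝ) ^ 2) ^ k * ρ ^ 2 * ((N : ℝ) * ‖(E : Matrix (Fin N) (Fin N) ℂ)‖ ^ 2) :=
            mul_le_mul_of_nonneg_left hEx (by positivity)
        _ = (16 * (N : ℝ) * (((F.P K).L : ℝ) ^ 2) ^ k * ρ ^ 2) * ‖(E : Matrix (Fin N) (Fin N) ℂ)‖ ^ 2 := by ring)
  exact le_of_mul_le_mul_right h2 hpos

end Record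

end Summit.QuantumFields.YangMills.BalabanUVNodes.N12FlatRightInverseLetterFloor
end
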